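import Summits.AtomisticToContinuum.FouriersLaw.Theorems.BondHeatUncertaintyLinearResponseFTURBondHeatVarianceContinuityHelper4

/-!
# Helper 5 for stub `stub_bondHeatVarianceContinuity` (crux ★ `LinearResponseFTUR`, stmt-AtomisticToContinuum-9122):
# weak convergence of the NESS family tested on exponentially growing observables

Support file for line `lebesgue-flip-duality`, stub K6b. Weak convergence `μ_δ ⇒ μ_T` (Helper 4) plus the
uniform exponential moments `∫ e^{H/(2T)} dμ_δ ≤ M` (Helper 3) upgrade to convergence of `∫ g dμ_δ` for every
continuous `g` with `|g| ≤ C e^{ϑ'H}`, `0 ≤ ϑ' < 1/(2T)` (`ness_tendsto_integral_of_growth`): truncate `g`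
with the continuous energy cutoff `χ_K(H) = (K + 1 - H)⁺ ∧ 1`, the bounded part converges weakly and the
tails are `≤ C e^{-(ϑ-ϑ')K} M` uniformly in `δ`. Nothing here closes an item.
-/

noncomputable section

namespace Summit.AtomisticToContinuum.FouriersLaw.Theorems.LinearResponseFTUR

open MeasureTheory ProbabilityTheory Filter Topology Set
open scoped NNReal ENNReal Topology
open Literature.MathematicalPhysics.KineticTheory.HeatConduction Literature.Probability.Process OscillatorChain
open Summit.AtomisticToContinuum.FouriersLaw.Theorems.BondHeatUncertainty

/-- **Weak convergence of the NESS family on exponentially dominated observables** (registered sub-goal of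
`stub_bondHeatVarianceContinuity`): for the pinned chain (all parameters `> 0`), under weak-NESS uniqueness
and along a steady-state family `μ`, for `T > 0`, `N ≥ 2`, and a continuous `g` with `|g| ≤ C e^{ϑ'H}`,
`0 ≤ ϑ' < 1/(2T)`: `g` is integrable under every `μ_{N,T+δ/2,T-δ/2}`, `|δ| ≤ T`, and
`∫ g dμ_{N,T+δ/2,T-δ/2} → ∫ g dμ_{N,T,T}` as `δ → 0`, `δ ≠ 0` (energy truncation + Helpers 3 and 4). [folklore] -/
theorem ness_tendsto_integral_of_growth :
    ∀ ω₂ lam β γ : ℝ, 0 < ω₂ → 0 < lam → 0 < β → 0 < γ →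
    (∀ (N : ℕ) (T_L T_R : ℝ), 0 < T_L → 0 < T_R → ∀ μ ν : Measure (PhaseSpace N),
      (pinnedChain ω₂ lam β γ).IsSteadyState N T_L T_R μ →
      (pinnedChain ω₂ lam β γ).IsSteadyState N T_L T_R ν → μ = ν) →
    ∀ μ : (N : ℕ) → ℝ → ℝ → Measure (PhaseSpace N),
      (∀ (N : ℕ) (T_L T_R : ℝ), 0 < T_L → 0 < T_R →
        (pinnedChain ω₂ lam β γ).IsSteadyState N T_L T_R (μ N T_L T_R)) →
    ∀ T : ℝ, 0 < T → ∀ (N : ℕ), 2 ≤ N →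
    ∀ g : PhaseSpace N → ℝ, Continuous g → ∀ C ϑ' : ℝ, 0 ≤ ϑ' → ϑ' < 1 / (2 * T) →
      (∀ x, |g x| ≤ C * Real.exp (ϑ' * (pinnedChain ω₂ lam β γ).hamiltonian N x)) →
      (∀ δ : ℝ, |δ| ≤ T → Integrable g (μ N (T + δ / 2) (T - δ / 2))) ∧
      Tendsto (fun δ : ℝ => ∫ x, g x ∂(μ N (T + δ / 2) (T - δ / 2))) (𝓝[≠] 0)
        (𝓝 (∫ x, g x ∂(μ N T T))) := by
  intro ω₂ lam β γ hω hl hβ hγ huniq μ hμ T hT N hN g hg C ϑ' hϑ'0 hϑ'1 hgC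
  set P := pinnedChain ω₂ lam β γ with hP
  set H := P.hamiltonian N with hH
  have hHc : Continuous H := pinnedChain_continuous_hamiltonian ω₂ lam β γ N
  have hH0 : ∀ x, 0 ≤ H x := fun x => pinnedChain_hamiltonian_nonneg hω.le hl.le hβ.le γ N x
  set ϑ : ℝ := 1 / (2 * T) with hϑ
  have hϑ0 : 0 < ϑ := by positivity
  set V : PhaseSpace N → ℝ := fun x => Real.exp (ϑ * H x) with hV
  obtain ⟨M, hM⟩ := ness_uniform_exp_moment ω₂ lam β γ hω hl hβ hγ huniq μ hμ T hT N hN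
  have hM0 := hM 0 (by simpa using hT.le)
  simp only [zero_div, add_zero, sub_zero] at hM0
  have hMnn : 0 ≤ M := le_trans (integral_nonneg fun x => (Real.exp_pos _).le) hM0.2
  -- `0 ≤ C`
  have hC0 : 0 ≤ C := by
    by_contra h
    push Not at h
    have h1 : C * Real.exp (ϑ' * H 0) < 0 := mul_neg_of_neg_of_pos h (Real.exp_pos _)
    linarith only [h1, hgC 0, abs_nonneg (g 0)]
  -- domination `|g| ≤ C V`
  have hexp_le : ∀ x, Real.exp (ϑ' * H x) ≤ V x := fun x =>
    Real.exp_le_exp.2 (mul_le_mul_of_nonneg_right hϑ'1.le (hH0 x))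
  have hdom : ∀ x, ‖g x‖ ≤ C * V x := fun x => by
    rw [Real.norm_eq_abs]
    exact (hgC x).trans (mul_le_mul_of_nonneg_left (hexp_le x) hC0)
  have hint_of : ∀ ν : Measure (PhaseSpace N), Integrable V ν → Integrable g ν := fun ν hν =>
    (hν.const_mul C).mono' hg.aestronglyMeasurable (Eventually.of_forall hdom)
  have hintδ : ∀ δ : ℝ, |δ| ≤ T → Integrable g (μ N (T + δ / 2) (T - δ / 2)) := fun δ hδ =>
    hint_of _ (hM δ hδ).1
  refine ⟨hintδ, ?_⟩
  -- the continuous energy cutoff and the truncated observable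
  let χ : ℝ → PhaseSpace N → ℝ := fun K x => max 0 (min 1 (K + 1 - H x))
  have hχc : ∀ K, Continuous (χ K) := fun K =>
    continuous_const.max (continuous_const.min (continuous_const.sub hHc))
  have hχ0 : ∀ K x, 0 ≤ χ K x := fun K x => le_max_left _ _
  have hχ1 : ∀ K x, χ K x ≤ 1 := fun K x => max_le zero_le_one (min_le_left _ _)
  have hχ_one : ∀ K x, H x ≤ K → χ K x = 1 := fun K x hx => by
    show max 0 (min 1 (K + 1 - H x)) = 1
    rw [min_eq_left (by linarith only [hx]), max_eq_right zero_le_one]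
  have hχ_zero : ∀ K x, K + 1 ≤ H x → χ K x = 0 := fun K x hx => by
    show max 0 (min 1 (K + 1 - H x)) = 0
    rw [max_eq_left]
    exact min_le_of_right_le (by linarith only [hx])
  let gK : ℝ → PhaseSpace N → ℝ := fun K x => χ K x * g x
  have hgKc : ∀ K, Continuous (gK K) := fun K => (hχc K).mul hg
  have hgK_bd : ∀ K x, |gK K x| ≤ C * Real.exp (ϑ' * (K + 1)) := by
    intro K x
    show |χ K x * g x| ≤ _
    by_cases hx : H x ≤ K + 1
    · rw [abs_mul, abs_of_nonneg (hχ0 K x)]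
      calc χ K x * |g x| ≤ 1 * |g x| := mul_le_mul_of_nonneg_right (hχ1 K x) (abs_nonneg _)
        _ ≤ C * Real.exp (ϑ' * H x) := by rw [one_mul]; exact hgC x
        _ ≤ C * Real.exp (ϑ' * (K + 1)) :=
            mul_le_mul_of_nonneg_left (Real.exp_le_exp.2 (mul_le_mul_of_nonneg_left hx hϑ'0)) hC0
    · rw [hχ_zero K x (le_of_lt (not_le.1 hx)), zero_mul, abs_zero]
      positivity
  -- the tails
  have htail : ∀ K x, ‖g x - gK K x‖ ≤ C * Real.exp (-((ϑ - ϑ') * K)) * V x := by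
    intro K x
    show ‖g x - χ K x * g x‖ ≤ _
    by_cases hx : H x ≤ K
    · rw [hχ_one K x hx, one_mul, sub_self, norm_zero]
      positivity
    · have hxK : K < H x := not_le.1 hx
      have h1 : ‖g x - χ K x * g x‖ ≤ |g x| := by
        rw [show g x - χ K x * g x = (1 - χ K x) * g x by ring, norm_mul, Real.norm_eq_abs, Real.norm_eq_abs,
          abs_of_nonneg (by linarith only [hχ1 K x])]
        calc (1 - χ K x) * |g x| ≤ 1 * |g x| :=
              mul_le_mul_of_nonneg_right (by linarith only [hχ0 K x]) (abs_nonneg _)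
          _ = |g x| := one_mul _
      refine h1.trans ((hgC x).trans ?_)
      rw [mul_assoc, ← Real.exp_add]
      refine mul_le_mul_of_nonneg_left (Real.exp_le_exp.2 ?_) hC0
      have : (ϑ - ϑ') * K ≤ (ϑ - ϑ') * H x := mul_le_mul_of_nonneg_left hxK.le (by linarith only [hϑ'1])
      nlinarith only [this]
  have htail_int : ∀ K (ν : Measure (PhaseSpace N)), Integrable V ν → ∫ x, V x ∂ν ≤ M →
      dist (∫ x, g x ∂ν) (∫ x, gK K x ∂ν) ≤ C * Real.exp (-((ϑ - ϑ') * K)) * M := by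
    intro K ν hν hνM
    have hgi : Integrable g ν := hint_of ν hν
    have hgKi : Integrable (gK K) ν := by
      refine hgi.norm.mono' (hgKc K).aestronglyMeasurable (Eventually.of_forall fun x => ?_)
      show ‖χ K x * g x‖ ≤ ‖g x‖
      rw [norm_mul, Real.norm_eq_abs, abs_of_nonneg (hχ0 K x)]
      calc χ K x * ‖g x‖ ≤ 1 * ‖g x‖ := mul_le_mul_of_nonneg_right (hχ1 K x) (norm_nonneg _)
        _ = ‖g x‖ := one_mul _
    rw [dist_eq_norm, ← integral_sub hgi hgKi]
    calc ‖∫ x, (g x - gK K x) ∂ν‖ ≤ ∫ x, ‖g x - gK K x‖ ∂ν := norm_integral_le_integral_norm _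
      _ ≤ ∫ x, C * Real.exp (-((ϑ - ϑ') * K)) * V x ∂ν :=
          integral_mono_of_nonneg (Eventually.of_forall fun x => norm_nonneg _) (hν.const_mul _)
            (Eventually.of_forall (htail K))
      _ = C * Real.exp (-((ϑ - ϑ') * K)) * ∫ x, V x ∂ν := integral_const_mul _ _
      _ ≤ C * Real.exp (-((ϑ - ϑ') * K)) * M := mul_le_mul_of_nonneg_left hνM (by positivity)
  -- the `3ε` argument
  rw [Metric.tendsto_nhds]
  intro ε hε
  have hr : 0 < ϑ - ϑ' := by linarith only [hϑ'1]
  have hK : ∃ K : ℝ, C * Real.exp (-((ϑ - ϑ') * K)) * M < ε / 3 := by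
    have h1 : Tendsto (fun K : ℝ => C * Real.exp (-((ϑ - ϑ') * K)) * M) atTop (𝓝 (C * 0 * M)) :=
      ((Real.tendsto_exp_neg_atTop_nhds_zero.comp (tendsto_id.const_mul_atTop hr)).const_mul C).mul_const M
    rw [mul_zero, zero_mul] at h1
    exact (h1.eventually (gt_mem_nhds (by positivity))).exists
  obtain ⟨K, hKε⟩ := hK
  have hwk := ness_tendsto_integral ω₂ lam β γ hω hl hβ hγ huniq μ hμ T hT N hN (gK K) (hgKc K)
    (C * Real.exp (ϑ' * (K + 1))) (hgK_bd K)
  rw [Metric.tendsto_nhds] at hwk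
  have hbox : ∀ᶠ δ : ℝ in 𝓝[≠] 0, |δ| ≤ T := by
    have : Metric.closedBall (0 : ℝ) T ∈ 𝓝[≠] (0 : ℝ) :=
      mem_nhdsWithin_of_mem_nhds (Metric.closedBall_mem_nhds 0 hT)
    filter_upwards [this] with δ hδ
    simpa [Real.dist_eq] using hδ
  filter_upwards [hwk (ε / 3) (by positivity), hbox] with δ hδ hδT
  have h1 := htail_int K (μ N (T + δ / 2) (T - δ / 2)) (hM δ hδT).1 (hM δ hδT).2
  have h3 := htail_int K (μ N T T) hM0.1 hM0.2
  calc dist (∫ x, g x ∂(μ N (T + δ / 2) (T - δ / 2))) (∫ x, g x ∂(μ N T T))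
      ≤ dist (∫ x, g x ∂(μ N (T + δ / 2) (T - δ / 2))) (∫ x, gK K x ∂(μ N (T + δ / 2) (T - δ / 2))) +
          dist (∫ x, gK K x ∂(μ N (T + δ / 2) (T - δ / 2))) (∫ x, gK K x ∂(μ N T T)) +
          dist (∫ x, gK K x ∂(μ N T T)) (∫ x, g x ∂(μ N T T)) := dist_triangle4 _ _ _ _
    _ < ε / 3 + ε / 3 + ε / 3 := by
        refine add_lt_add_of_lt_of_le (add_lt_add_of_le_of_lt (h1.trans hKε.le) hδ) ?_
        rw [dist_comm]
        exact h3.trans hKε.le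
    _ = ε := by ring

end Summit.AtomisticToContinuum.FouriersLaw.Theorems.LinearResponseFTUR

end
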